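import Summits.CriticalPhenomena.Ising3DConformalLimit.Theorems.AnomalousForcesInteractionEtaPositiveOfIsotherm
import Summits.CriticalPhenomena.Ising3DConformalLimit.Theorems.InverseSquareTelemetryPowerLawFromTelemetry
import Summits.CriticalPhenomena.Ising3DConformalLimit.Theorems.PerfectScreeningGaussianLimitIsCoulombReductions
import Literature.Probability.LatticeModels.IsingExponents
import Literature.Probability.LatticeModels.CriticalEtaUpperDCPProofs
import Literature.Probability.LatticeModels.CriticalTwoPointDCPLowerHolds
import HarnessLib

/-!
# Crux `EtaPositive` (stmt-CriticalPhenomena-2600) in the exponent vocabulary of the Literature: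
# the Buckingham–Gunton inequality on `ℤ³`

Route `AnomalousForcesInteraction` (Ising3DConformalLimit), line `birth`. The line closed the crux modulo its one
open stub `stub_isothermGain` ("`1/δ > 1/5` in upper-bound form", `EtaPositive_of_isothermGain`, landed in
`Theorems/AnomalousForcesInteractionEtaPositiveOfIsotherm.lean`) through the effective Buckingham–Gunton reduction
`criticalTwoPoint_decay_of_isotherm` (`m(β_c(3),h) ≤ A h^b` on `(0,h₀]` ⟹ `⟨σ₀σ_x⟩_{β_c(3)} ≤ C‖x‖^{-6b/(b+1)}`).
This file restates those lattice theorems in the vocabulary of the Literature's critical-exponent predicates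
(`Literature/Probability/LatticeModels/IsingExponents.lean`: `HasIsingExponentDelta d δ` — `log m(β_c,h)/log h → 1/δ`
as `h ↓ 0`; `HasIsingExponentEta d η` — `log ⟨σ₀σ_x⟩_{β_c}/log ‖x‖ → -(d-2+η)`), so that the crux is connected to the
conjunct **crit-ising.S22/S23** language in which the 3D exponents are discussed:

* `isotherm_le_rpow_of_hasIsingExponentDelta` — if `δ` exists then `m(β_c,h) ≤ h^b` near `h = 0⁺` for every
  `b < 1/δ` (logarithmic exponent ⟹ power upper bound with an `ε`-loss);
* `isothermGain_of_hasIsingExponentDelta_lt_five` — `δ(3) < 5` (with `δ(3)` existing) gives the registered stub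
  `stub_isothermGain` verbatim, hence `EtaPositive_of_hasIsingExponentDelta_lt_five` : the crux BY NAME from
  "`δ(3)` exists and `δ(3) < 5`";
* `criticalTwoPoint_decay_of_hasIsingExponentDelta` — if `δ(3)` exists then `⟨σ₀σ_x⟩_{β_c(3)} ≤ C‖x‖^{-a}` for EVERY
  `a < 6/(δ+1)`;
* `buckinghamGunton_three` — **the Buckingham–Gunton inequality for the nearest-neighbour Ising model on `ℤ³`**:
  if `δ(3)` and `η(3)` exist (logarithmic sense) then `(5-δ)/(δ+1) ≤ η`, i.e. `2 - η ≤ 3(δ-1)/(δ+1)`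
  (Buckingham–Gunton, Phys. Rev. 178 (1969) 848; Fisher, Phys. Rev. 180 (1969) 594; recorded in
  Fernández–Fröhlich–Sokal 1992, §14 — here a theorem about the genuine `ℤ³` model, from GHS + GKS +
  Messager–Miracle-Solé through the landed reduction);
* `etaPositive_of_hasIsingExponentEta_pos` — `η(3) > 0` in the logarithmic sense already gives the crux
  (power upper bound with `κ = η/2`), and `isingEta_pos_of_hasIsingExponentDelta_lt_five` — with both exponents
  existing, `δ < 5 ⟹ η > 0`;
* `three_le_isingDelta_of_exponents` — sanity check in the other direction: Buckingham–Gunton combined with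
  Duminil-Copin–Panis 2025 (`η ≤ 1/2` if `η` exists, `dcp_isingEta_le_half_holds`) returns `δ ≥ 3` whenever both
  exponents exist (the mean-field bound of Aizenman–Barsky–Fernández 1987 in exponent form, here as a by-product).

No named fact is assumed and nothing here is the crux in costume: every statement is either an implication between
exponent predicates or a pre-paid closing of the crux from a hypothesis on the FIELD sector (`δ`). What remains open
is exactly the input: no power-law upper bound on the critical isotherm of `ℤ³` (any `b > 0`, a fortiori `δ < 5`) is
a theorem in print (cf. `Cruxes/EtaPositive/PROMOTE.md`).
-/

noncomputable section

namespace Summit.CriticalPhenomena.Ising3DConformalLimit.AnomalousForcesInteractionEtaPositive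

open Literature.Probability.LatticeModels Filter Set
open scoped Topology

/-! ### From logarithmic exponents to power bounds -/

/-- **Logarithmic right power law ⟹ power upper bound with a loss.** If `log f(x)/log (x-x₀) → κ` as `x ↓ x₀`
then for every `b < κ` there is `ε > 0` with `f(x) ≤ (x-x₀)^b` for `x₀ < x < x₀ + ε` (for `0 < x - x₀ < 1` the
logarithm is negative, so `b < log f/log(x-x₀)` reads `log f < b log (x-x₀)`; non-positive values of `f` satisfy
the bound trivially). Elementary. -/
theorem hasRightPowerLaw_exists_le_rpow {f : ℝ → ℝ} {x₀ κ b : ℝ} (hf : HasRightPowerLaw f x₀ κ)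
    (hb : b < κ) : ∃ ε : ℝ, 0 < ε ∧ ∀ x : ℝ, x₀ < x → x < x₀ + ε → f x ≤ (x - x₀) ^ b := by
  have h1 : ∀ᶠ x in 𝓝[>] x₀, b < Real.log (f x) / Real.log (x - x₀) :=
    hf.eventually (Ioi_mem_nhds hb)
  obtain ⟨u, hu, hsub⟩ := mem_nhdsGT_iff_exists_Ioo_subset.1 h1
  refine ⟨min (u - x₀) 1, lt_min (sub_pos.2 hu) one_pos, fun x hx₀ hxu => ?_⟩
  have hxu' : x < u := by
    have := min_le_left (u - x₀) 1
    linarith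
  have hx1 : x - x₀ < 1 := by
    have := min_le_right (u - x₀) 1
    linarith
  have ht0 : 0 < x - x₀ := sub_pos.2 hx₀
  have hlogt : Real.log (x - x₀) < 0 := Real.log_neg ht0 hx1
  have hkey : b < Real.log (f x) / Real.log (x - x₀) := hsub ⟨hx₀, hxu'⟩
  have hlogf : Real.log (f x) < b * Real.log (x - x₀) := (lt_div_iff_of_neg hlogt).1 hkey
  have hpow : 0 < (x - x₀) ^ b := Real.rpow_pos_of_pos ht0 _
  by_cases hfx : f x ≤ 0
  · exact hfx.trans hpow.le
  · push Not at hfx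
    have h2 : Real.log (f x) < Real.log ((x - x₀) ^ b) := by
      rwa [Real.log_rpow ht0]
    exact ((Real.log_lt_log_iff hfx hpow).1 h2).le

/-- **If `δ` exists then the critical isotherm is bounded by every power below `1/δ`**: from
`HasIsingExponentDelta d δ` (`log m(β_c,h)/log h → 1/δ` as `h ↓ 0`), for every `b < δ⁻¹` there is `h₀ > 0` with
`m(β_c, h) ≤ h^b` for all `h ∈ (0, h₀]`. Elementary (the `o(1)` of the exponent absorbed into the gap `δ⁻¹ - b`). -/
theorem isotherm_le_rpow_of_hasIsingExponentDelta {d : ℕ} {δ b : ℝ} (hδ : HasIsingExponentDelta d δ)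
    (hb : b < δ⁻¹) :
    ∃ h₀ : ℝ, 0 < h₀ ∧ ∀ h : ℝ, 0 < h → h ≤ h₀ → magnetizationInField d (criticalBeta d) h ≤ h ^ b := by
  obtain ⟨ε, hε, H⟩ := hasRightPowerLaw_exists_le_rpow hδ hb
  refine ⟨ε / 2, by positivity, fun h hh hhε => ?_⟩
  have := H h (by simpa using hh) (by linarith)
  simpa using this

/-- **`δ(3) < 5` gives the registered stub `stub_isothermGain` of crux stmt-CriticalPhenomena-2600 verbatim**:
if the critical-isotherm exponent `δ` of the nearest-neighbour Ising model on `ℤ³` exists and `δ < 5`, then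
`m(β_c(3), h) ≤ A h^b` on `(0, h₀]` for some `b > 1/5` (any `b` strictly between `1/5` and `1/δ`, `A = 1`). -/
theorem isothermGain_of_hasIsingExponentDelta_lt_five {δ : ℝ} (hδ0 : 0 < δ) (hδ5 : δ < 5)
    (hδ : HasIsingExponentDelta 3 δ) :
    ∃ b A h₀ : ℝ, 1 / 5 < b ∧ 0 < h₀ ∧ ∀ h : ℝ, 0 < h → h ≤ h₀ →
      magnetizationInField 3 (criticalBeta 3) h ≤ A * h ^ b := by
  have h15 : (1 : ℝ) / 5 < δ⁻¹ := by
    rw [← one_div]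
    exact one_div_lt_one_div_of_lt hδ0 hδ5
  obtain ⟨b, hb1, hb2⟩ := exists_between h15
  obtain ⟨h₀, hh₀, H⟩ := isotherm_le_rpow_of_hasIsingExponentDelta hδ hb2
  exact ⟨b, 1, h₀, hb1, hh₀, fun h hh hle => by simpa using H h hh hle⟩

/-- **The crux `EtaPositive` from "`δ(3)` exists and `δ(3) < 5`"** (pre-paid closing in the Literature's exponent
vocabulary): `HasIsingExponentDelta 3 δ` with `0 < δ < 5` implies
`Summit.CriticalPhenomena.Ising3DConformalLimit.Theses.AnomalousForcesInteraction.EtaPositive`, by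
`isothermGain_of_hasIsingExponentDelta_lt_five` and the landed `EtaPositive_of_isothermGain`
(`κ = (5b-1)/(b+1)` for any `1/5 < b < 1/δ`). Conjecturally `δ(3) = 4.79`. -/
theorem EtaPositive_of_hasIsingExponentDelta_lt_five :
    (∃ δ : ℝ, 0 < δ ∧ δ < 5 ∧ HasIsingExponentDelta 3 δ) →
    Summit.CriticalPhenomena.Ising3DConformalLimit.Theses.AnomalousForcesInteraction.EtaPositive :=
  fun ⟨_, hδ0, hδ5, hδ⟩ => EtaPositive_of_isothermGain (isothermGain_of_hasIsingExponentDelta_lt_five hδ0 hδ5 hδ)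

/-! ### The Buckingham–Gunton inequality on `ℤ³` -/

/-- For `x ≠ 0` in `ℤ^d` the sup norm is at least `1`. -/
theorem one_le_norm_of_ne_zero {d : ℕ} {x : Site d} (hx : x ≠ 0) : (1 : ℝ) ≤ ‖x‖ := by
  rw [Site.norm_eq_supNorm]
  have h0 : Site.supNorm x ≠ 0 := fun h => hx (Site.supNorm_eq_zero_iff.1 h)
  exact_mod_cast Nat.one_le_iff_ne_zero.2 h0

/-- **Buckingham–Gunton in decay form**: if the critical-isotherm exponent `δ` of the nearest-neighbour Ising model
on `ℤ³` exists, then for EVERY `a < 6/(δ+1)` there is `C` with `⟨σ₀σ_x⟩_{β_c(3)} ≤ C‖x‖^{-a}` for all `x ≠ 0`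
(sup norm). Proof: for `a ≤ 0` the bound `⟨σ₀σ_x⟩ ≤ 1` suffices; for `a > 0` pick `b` with `a/(6-a) < b < 1/δ`
(possible iff `a < 6/(δ+1)`), so that `m(β_c,h) ≤ h^b` near `0⁺` (`isotherm_le_rpow_of_hasIsingExponentDelta`)
and `6b/(b+1) ≥ a`; then `criticalTwoPoint_decay_of_isotherm` gives the exponent `6b/(b+1)`, and `‖x‖ ≥ 1`
trades it for `a`. (Buckingham–Gunton 1969 / Fisher 1969, `2 - η ≤ d(δ-1)/(δ+1)` at `d = 3`, upper-bound form.) -/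
theorem criticalTwoPoint_decay_of_hasIsingExponentDelta {δ : ℝ} (hδ0 : 0 < δ)
    (hδ : HasIsingExponentDelta 3 δ) {a : ℝ} (ha : a < 6 / (δ + 1)) :
    ∃ C : ℝ, ∀ x : Site 3, x ≠ 0 → criticalTwoPoint 3 x ≤ C * (‖x‖ : ℝ) ^ (-a) := by
  have hG1 : ∀ x : Site 3, criticalTwoPoint 3 x ≤ 1 := fun x =>
    twoPointPlus_le_one_of_nonneg (criticalBeta_nonneg 3) x
  by_cases ha0 : a ≤ 0
  · -- trivial range: `G ≤ 1 ≤ ‖x‖^{-a}`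
    refine ⟨1, fun x hx => ?_⟩
    have h1 : (1 : ℝ) ≤ ‖x‖ ^ (-a) := Real.one_le_rpow (one_le_norm_of_ne_zero hx) (by linarith)
    calc criticalTwoPoint 3 x ≤ 1 := hG1 x
      _ ≤ 1 * ‖x‖ ^ (-a) := by simpa using h1
  push Not at ha0
  have hδ1 : 0 < δ + 1 := by linarith
  have ha6 : a < 6 := by
    have h1 : 6 / (δ + 1) ≤ 6 := by
      rw [div_le_iff₀ hδ1]
      nlinarith
    linarith
  have h6a : 0 < 6 - a := by linarith
  -- the isotherm exponent `b` with `a/(6-a) < b < 1/δ`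
  have hb₀ : a / (6 - a) < δ⁻¹ := by
    rw [div_lt_iff₀ h6a, ← div_eq_inv_mul] at *
    · rw [lt_div_iff₀ hδ0]
      rw [lt_div_iff₀ hδ1] at ha
      nlinarith
  obtain ⟨b, hb1, hb2⟩ := exists_between hb₀
  have hb0 : 0 < b := lt_trans (div_pos ha0 h6a) hb1
  have hb1' : 0 < b + 1 := by linarith
  have hab : a ≤ 6 * b / (b + 1) := by
    rw [le_div_iff₀ hb1']
    rw [div_lt_iff₀ h6a] at hb1
    nlinarith
  obtain ⟨h₀, hh₀, H⟩ := isotherm_le_rpow_of_hasIsingExponentDelta hδ hb2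
  obtain ⟨C, hC⟩ := criticalTwoPoint_decay_of_isotherm b 1 h₀ hb0 hh₀
    (fun h hh hle => by simpa using H h hh hle)
  refine ⟨max C 0, fun x hx => (hC x hx).trans ?_⟩
  have hn1 : (1 : ℝ) ≤ ‖x‖ := one_le_norm_of_ne_zero hx
  have hr0 : 0 ≤ (‖x‖ : ℝ) ^ (-(6 * b / (b + 1))) := Real.rpow_nonneg (by positivity) _
  calc C * (‖x‖ : ℝ) ^ (-(6 * b / (b + 1))) ≤ max C 0 * (‖x‖ : ℝ) ^ (-(6 * b / (b + 1))) :=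
        mul_le_mul_of_nonneg_right (le_max_left _ _) hr0
    _ ≤ max C 0 * (‖x‖ : ℝ) ^ (-a) :=
        mul_le_mul_of_nonneg_left (Real.rpow_le_rpow_of_exponent_le hn1 (by linarith)) (le_max_right _ _)

/-- **The Buckingham–Gunton inequality for the nearest-neighbour Ising model on `ℤ³`.** If the critical-isotherm
exponent `δ` and the anomalous dimension `η` of `ℤ³` both exist (logarithmic sense of
`Literature.Probability.LatticeModels.IsingExponents`), then `(5 - δ)/(δ + 1) ≤ η`, i.e. `1 + η ≥ 6/(δ+1)`,
i.e. `2 - η ≤ 3(δ-1)/(δ+1)` — the `d = 3` case of `2 - η ≤ d(δ-1)/(δ+1)` (M. J. Buckingham, J. D. Gunton,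
Phys. Rev. 178 (1969) 848; M. E. Fisher, Phys. Rev. 180 (1969) 594; Fernández–Fröhlich–Sokal, *Random walks,
critical phenomena, and triviality in quantum field theory* (1992), §14). Proof: every `a < 6/(δ+1)` is an
upper decay exponent (`criticalTwoPoint_decay_of_hasIsingExponentDelta`), hence `a ≤ 1 + η` (the tree lemma
`PerfectScreeningGaussianLimitIsCoulomb.hasSpatialDecayExponent_ge_of_upper_bound` with Simon–Lieb positivity
`Theorems.criticalTwoPoint_three_pos_of_ne_zero`), and `6/(δ+1) ≤ 1 + η` by density. -/
theorem buckinghamGunton_three :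
    ∀ {δ η : ℝ}, 0 < δ → HasIsingExponentDelta 3 δ → HasIsingExponentEta 3 η → (5 - δ) / (δ + 1) ≤ η := by
  intro δ η hδ0 hδ hη
  have hδ1 : 0 < δ + 1 := by linarith
  have hmain : 6 / (δ + 1) ≤ 1 + η := by
    refine le_of_forall_lt_imp_le_of_dense fun a ha => ?_
    obtain ⟨C, hC⟩ := criticalTwoPoint_decay_of_hasIsingExponentDelta hδ0 hδ ha
    have h1 : a ≤ ((3 : ℕ) : ℝ) - 2 + η :=
      PerfectScreeningGaussianLimitIsCoulomb.hasSpatialDecayExponent_ge_of_upper_bound hη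
        (fun x hx => Theorems.criticalTwoPoint_three_pos_of_ne_zero hx) hC
    push_cast at h1
    linarith
  have heq : (5 - δ) / (δ + 1) = 6 / (δ + 1) - 1 := by
    field_simp
    ring
  rw [heq]
  linarith

/-- **With both exponents existing, `δ(3) < 5` forces `η(3) > 0`** (Buckingham–Gunton read contrapositively — the
slogan of line `birth`, now literally in exponent language). -/
theorem isingEta_pos_of_hasIsingExponentDelta_lt_five {δ η : ℝ} (hδ0 : 0 < δ) (hδ5 : δ < 5)
    (hδ : HasIsingExponentDelta 3 δ) (hη : HasIsingExponentEta 3 η) : 0 < η :=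
  lt_of_lt_of_le (div_pos (by linarith) (by linarith)) (buckinghamGunton_three hδ0 hδ hη)

/-- **Sanity check in the converse direction: `δ(3) ≥ 3` whenever `δ(3)` and `η(3)` exist**, from Buckingham–Gunton
`(5-δ)/(δ+1) ≤ η` and Duminil-Copin–Panis 2025, Theorem 1.5 (`η ≤ 1/2` if `η` exists on `ℤ³`,
`dcp_isingEta_le_half_holds`): `(5-δ)/(δ+1) ≤ 1/2 ⟺ δ ≥ 3`. (The unconditional mean-field bound `δ ≥ 3` is
Aizenman–Barsky–Fernández 1987; this by-product only records that the two exponent inequalities are consistent,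
and jointly saturated exactly at the corner `δ = 3, η = 1/2` of the rigorous window.) -/
theorem three_le_isingDelta_of_exponents {δ η : ℝ} (hδ0 : 0 < δ) (hδ : HasIsingExponentDelta 3 δ)
    (hη : HasIsingExponentEta 3 η) : 3 ≤ δ := by
  have h1 : (5 - δ) / (δ + 1) ≤ η := buckinghamGunton_three hδ0 hδ hη
  have h2 : η ≤ 1 / 2 := dcp_isingEta_le_half_holds η hη
  have hδ1 : 0 < δ + 1 := by linarith
  have h3 : (5 - δ) / (δ + 1) ≤ 1 / 2 := h1.trans h2
  rw [div_le_iff₀ hδ1] at h3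
  linarith

/-! ### The crux from a positive logarithmic `η` -/

/-- **`η(3) > 0` in the logarithmic sense already gives the crux.** If `log ⟨σ₀σ_x⟩_{β_c(3)}/log ‖x‖ → -(1+η)` with
`η > 0` (`HasIsingExponentEta 3 η`), then `EtaPositive` holds with `κ = η/2`: the `ε`-loss bound
`⟨σ₀σ_x⟩ ≤ K‖x‖^{-(1+η)+ε}` (`HasSpatialDecayExponent.exists_le_mul_rpow`) at `ε = η/2`. So the power-upper-bound
form of the crux costs nothing beyond the sign of `η`; in particular the Literature conjecture
`CritIsing3DExponentValues` (crit-ising.S23: `η = 2Δ_σ - 1 ∈ [0.0362958, 0.0362998]`) implies the crux — recorded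
only as a consistency check (S23 contains the summit statement itself). -/
theorem etaPositive_of_hasIsingExponentEta_pos {η : ℝ} (hη0 : 0 < η) (hη : HasIsingExponentEta 3 η) :
    Summit.CriticalPhenomena.Ising3DConformalLimit.Theses.AnomalousForcesInteraction.EtaPositive := by
  obtain ⟨K, -, hK⟩ := HasSpatialDecayExponent.exists_le_mul_rpow hη (ε := η / 2) (by positivity)
  refine ⟨η / 2, K, by positivity, fun x hx => ?_⟩
  have h1 := hK x hx
  have h2 : -(((3 : ℕ) : ℝ) - 2 + η) + η / 2 = -(1 + η / 2) := by
    push_cast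
    ring
  rwa [h2] at h1

/-- **The crux from the two exponents**: if `δ(3)` and `η(3)` exist and `δ(3) < 5`, then `EtaPositive`
(`isingEta_pos_of_hasIsingExponentDelta_lt_five` + `etaPositive_of_hasIsingExponentEta_pos`; of course
`EtaPositive_of_hasIsingExponentDelta_lt_five` needs no `η` at all — this form is recorded for the exponent
bookkeeping of crit-ising.S22). -/
theorem EtaPositive_of_exponents {δ η : ℝ} (hδ0 : 0 < δ) (hδ5 : δ < 5) (hδ : HasIsingExponentDelta 3 δ)
    (hη : HasIsingExponentEta 3 η) :
    Summit.CriticalPhenomena.Ising3DConformalLimit.Theses.AnomalousForcesInteraction.EtaPositive :=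
  etaPositive_of_hasIsingExponentEta_pos (isingEta_pos_of_hasIsingExponentDelta_lt_five hδ0 hδ5 hδ hη) hη

end Summit.CriticalPhenomena.Ising3DConformalLimit.AnomalousForcesInteractionEtaPositive

end
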